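import Literature.AlgebraicTopology.SingularHomology.CircleIntegralCocycle
import Literature.AlgebraicTopology.SingularHomology.RelativeCapProduct
import Literature.AlgebraicTopology.FundamentalGroup.PathSegment
import HarnessLib

/-!
# Circle-valued maps: the winding functional `H₁(X; ℤ) → ℤ` and its computation from local lifts

A. Hatcher, *Algebraic Topology* (2002), §3.1 p. 198 (`H¹(X; ℤ) = Hom(H₁(X), ℤ)`, the Kronecker
pairing) with Thm. 1.7 / Prop. 1.30 (lifting through `ℝ → S¹`): a continuous map
`φ : X → S¹ = ℝ/ℤ` defines the class `φ^* θ ∈ H¹(X; ℤ)` (`θ = [ϑ]` the integral generator of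
`H¹(ℝ/ℤ)`, `CircleIntegralCocycle.lean`), hence the **winding functional**
`W_φ = ⟨φ^* θ, ·⟩ : H₁(X; ℤ) → ℤ`; on the Hurewicz class of a loop `γ` its value is the DEGREE of
`φ ∘ γ`, i.e. the increment `Λ(1) − Λ(0)` of any lift `Λ` of `φ ∘ γ` through `ℝ → ℝ/ℤ`
(`windingFunctional_loopClass`).  Consequences used by the de Rham side of the tree (closed
`1`-forms `dF` glued from local real lifts `F` of `φ`; `Literature/Geometry/Symplectic`,
Legendrian realisation of homologically essential page curves): the winding of `φ` along a loop
only depends on the homology class of the loop and is additive in it, and it is COMPUTED piece by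
piece from local lifts (`windAlong_eq_sum_of_lifts`: if `γ[t_k, t_{k+1}]` lies in a set on which
`φ = F_k mod 1` with `F_k` continuous there, the winding is `Σ_k (F_k(γ t_{k+1}) − F_k(γ t_k))`).

* `liftIncrement p = p̂(1) − p̂(0)` for a path `p` of `ℝ/ℤ` (`p̂ = pathLift p`), computed by ANY
  continuous lift (`liftIncrement_eq_of_lift`, uniqueness of lifts), an integer for loops
  (`liftIncrement_loop`), on segments `liftIncrement (p[s, t]) = p̂(t) − p̂(s)`
  (`liftIncrement_segment`), telescoping over partitions (`liftIncrement_eq_sum_segment`);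
* `windAlong φ γ = liftIncrement (φ ∘ γ)`; `windingFunctional φ = ⟨φ^*θ, ·⟩`;
* **`windingFunctional_loopClass`**: `W_φ (h γ) = windAlong φ γ` for every loop `γ`; hence
  `windAlong_eq_of_loopClass_eq`, `windAlong_eq_sum_of_loopClass_eq_sum` (homology invariance and
  additivity of the winding of loops);
* `windAlong_eq_of_lift`, `windAlong_segment_eq_of_lift`, **`windAlong_eq_sum_of_lifts`**:
  computation from (local) real lifts.

Everything is proved; no named facts.

## References
* A. Hatcher, *Algebraic Topology*, CUP 2002, Thm. 1.7, Prop. 1.30, §3.1 p. 191 (evaluation of a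
  cocycle on a cycle), p. 198. [HatcherAT2002]
-/

noncomputable section

open Set CategoryTheory

namespace Literature.AlgebraicTopology.SingularHomology

open SingularSimplex singularChainComplex singularCochainComplex HurewiczProof
open Literature.AlgebraicTopology.FundamentalGroup.PathSegment (segment segment_apply)

/-! ### The lift increment of a path of `ℝ/ℤ` -/

section Increment

variable {a b : UnitAddCircle}

/-- **The lift increment** `p̂(1) − p̂(0)` of a path `p` of `ℝ/ℤ` (`p̂` its lift through
`ℝ → ℝ/ℤ` from `[0, 1)`); for a loop, its degree. [cite: HatcherAT2002, Thm. 1.7] -/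
def liftIncrement (p : Path a b) : ℝ := pathLift p 1 - pathLift p 0

/-- **Any continuous lift computes the increment** (uniqueness of lifts up to an integer
translation). [cite: HatcherAT2002, Prop. 1.30] -/
theorem liftIncrement_eq_of_lift (p : Path a b) (G : C(unitInterval, ℝ))
    (hG : ∀ t, ((G t : ℝ) : UnitAddCircle) = p t) : liftIncrement p = G 1 - G 0 := by
  have h0 : ((circleRep a : ℝ) : UnitAddCircle) = ((G 0 : ℝ) : UnitAddCircle) := by
    rw [hG 0, p.source, coe_circleRep]
  obtain ⟨k, hk⟩ := exists_int_eq_sub_of_coe_eq h0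
  set G' : C(unitInterval, ℝ) := ⟨fun t => G t + k, G.continuous.add continuous_const⟩ with hG'def
  have hG' : G' = pathLift p := eq_pathLift G' (fun t => by
      show (((G t + k : ℝ)) : UnitAddCircle) = p t
      rw [coe_add_intCast, hG t]) (by show G 0 + k = circleRep a; rw [hk])
  rw [liftIncrement, ← hG']
  show (G 1 + k) - (G 0 + k) = G 1 - G 0
  ring

/-- **The increment of a loop is an integer**, namely `⌊p̂(1)⌋` (the lift starts in `[0, 1)`).
[cite: HatcherAT2002, Thm. 1.7] -/
theorem liftIncrement_loop (p : Path a a) : liftIncrement p = ⌊pathLift p 1⌋ := by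
  have h1 : ((pathLift p 1 : ℝ) : UnitAddCircle) = ((circleRep a : ℝ) : UnitAddCircle) := by
    rw [coe_pathLift, p.target, coe_circleRep]
  obtain ⟨k, hk⟩ := exists_int_eq_sub_of_coe_eq h1
  rw [liftIncrement, pathLift_zero, hk, Int.floor_add_intCast, floor_circleRep]
  push_cast
  ring

/-- The increment of a loop is the value of the winding cochain on its singular simplex.
[cite: HatcherAT2002, Thm. 1.7] -/
theorem liftIncrement_loop_eq_windingCochain (p : Path a a) :
    liftIncrement p = windingCochain (ofPath p) := by
  rw [liftIncrement_loop, windingCochain_eq, pathLift_congr (toPath_ofPath_apply p)]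

/-- **The increment on a segment**: `liftIncrement (p[s, t]) = p̂(t) − p̂(s)` for `s, t ∈ [0, 1]`
(the reparametrised lift is a lift of the segment). [cite: HatcherAT2002, Prop. 1.30] -/
theorem liftIncrement_segment (p : Path a b) (s t : unitInterval) :
    liftIncrement (segment p s t) = pathLift p t - pathLift p s := by
  set G : C(unitInterval, ℝ) :=
    ⟨fun u => pathLift p (projIcc 0 1 zero_le_one ((s : ℝ) + ((t : ℝ) - s) * u)),
      (pathLift p).continuous.comp (continuous_projIcc.comp (by fun_prop))⟩ with hGdef
  have hG : ∀ u, ((G u : ℝ) : UnitAddCircle) = segment p s t u := fun u => by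
    show (((pathLift p (projIcc 0 1 zero_le_one ((s : ℝ) + ((t : ℝ) - s) * u))) : ℝ) :
        UnitAddCircle) = _
    rw [coe_pathLift, segment_apply]
    rfl
  rw [liftIncrement_eq_of_lift _ G hG]
  show pathLift p (projIcc 0 1 zero_le_one ((s : ℝ) + ((t : ℝ) - s) * (1 : unitInterval))) -
      pathLift p (projIcc 0 1 zero_le_one ((s : ℝ) + ((t : ℝ) - s) * (0 : unitInterval))) = _
  have e1 : projIcc 0 1 zero_le_one ((s : ℝ) + ((t : ℝ) - s) * (1 : unitInterval)) = t := by
    rw [Set.Icc.coe_one, mul_one, add_sub_cancel, projIcc_val zero_le_one t]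
  have e0 : projIcc 0 1 zero_le_one ((s : ℝ) + ((t : ℝ) - s) * (0 : unitInterval)) = s := by
    rw [Set.Icc.coe_zero, mul_zero, add_zero, projIcc_val zero_le_one s]
  rw [e1, e0]

/-- **Telescoping over a partition**: for `t₀ = 0, t₁, …, tₙ = 1` in `[0, 1]`,
`liftIncrement p = Σ_k liftIncrement (p[t_k, t_{k+1}])`. [cite: HatcherAT2002, Prop. 1.30] -/
theorem liftIncrement_eq_sum_segment (p : Path a b) {n : ℕ} (t : Fin (n + 1) → unitInterval)
    (ht0 : t 0 = 0) (htn : t (Fin.last n) = 1) :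
    liftIncrement p = ∑ k : Fin n, liftIncrement (segment p (t k.castSucc) (t k.succ)) := by
  set T : ℕ → ℝ := fun i => if h : i < n + 1 then pathLift p (t ⟨i, h⟩) else 0 with hT
  have hTk : ∀ k : Fin (n + 1), pathLift p (t k) = T k := fun k => by
    simp only [hT, dif_pos k.2]
  have hsum : ∑ k : Fin n, liftIncrement (segment p (t k.castSucc) (t k.succ)) =
      ∑ i ∈ Finset.range n, (T (i + 1) - T i) := by
    rw [← Fin.sum_univ_eq_sum_range (fun i => T (i + 1) - T i) n]
    refine Finset.sum_congr rfl fun k _ => ?_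
    rw [liftIncrement_segment, hTk, hTk]
    rfl
  rw [hsum, Finset.sum_range_sub, liftIncrement]
  have h1 : T n = pathLift p 1 := by rw [← htn, hTk]; rfl
  have h0 : T 0 = pathLift p 0 := by rw [← ht0, hTk]; rfl
  rw [h1, h0]

end Increment

/-! ### The winding of a circle-valued map along a path, and the winding functional -/

section Winding

variable {X : Type} [TopologicalSpace X]

/-- **The winding of `φ : X → ℝ/ℤ` along a path `γ`**: the lift increment of `φ ∘ γ` (a real
number; an integer when `γ` is a loop). [cite: HatcherAT2002, Thm. 1.7] -/
def windAlong (φ : C(X, UnitAddCircle)) {x y : X} (γ : Path x y) : ℝ :=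
  liftIncrement (γ.map φ.continuous)

/-- **The winding functional** `W_φ = ⟨φ^* θ, ·⟩ : H₁(X; ℤ) → ℤ` of a circle-valued map (the
Kronecker pairing with the pulled-back generator of `H¹(ℝ/ℤ; ℤ)`).
[cite: HatcherAT2002, §3.1 p. 198] -/
def windingFunctional (φ : C(X, UnitAddCircle)) : singularHomology ℤ ℤ X 1 →ₗ[ℤ] ℤ :=
  kroneckerPairing ℤ ℤ X 1 (singularCohomology.map ℤ ℤ φ 1 (circleClass ℤ))

/-- **`⟨θ, h(p)⟩ = ϑ(p)`**: the generator of `H¹(ℝ/ℤ; ℤ)` evaluated on the Hurewicz class of a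
loop `p` of `ℝ/ℤ` is the winding cochain of `p` (evaluation of a cocycle on a one-simplex cycle).
[cite: HatcherAT2002, §3.1 p. 191] -/
theorem kroneckerPairing_circleClass_loopClass {a : UnitAddCircle} (p : Path a a) :
    kroneckerPairing ℤ ℤ UnitAddCircle 1 (circleClass ℤ) (loopClass ℤ ℤ (1 : ℤ) p) =
      windingCochain (ofPath p) := by
  set K := singularChainComplex ℤ ℤ UnitAddCircle
  have hz : K.d 1 0 (single (R := ℤ) (ofPath p) (1 : ℤ)) = 0 := by
    rw [d_single_ofPath, sub_self]
  let zc : cycles ℤ ℤ UnitAddCircle 1 := K.cyclesMk (single (R := ℤ) (ofPath p) (1 : ℤ)) 0 (by simp) hz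
  have hzc : iCycles ℤ ℤ UnitAddCircle 1 zc =
      ∑ i ∈ (Finset.univ : Finset Unit), single (R := ℤ) ((fun _ : Unit => ofPath p) i)
        ((fun _ : Unit => (1 : ℤ)) i) := by
    rw [Finset.univ_unique, Finset.sum_singleton]
    exact K.i_cyclesMk _ 0 (by simp) hz
  have hcls : loopClass ℤ ℤ (1 : ℤ) p = K.homologyπ 1 zc :=
    homologyCls_eq_homologyπ_cyclesMk _ _ 0 (by simp) hz
  rw [hcls, circleClass, kroneckerPairing_π_single Finset.univ (fun _ : Unit => ofPath p)
    (fun _ : Unit => (1 : ℤ)) (circleCocycle ℤ) zc hzc, Finset.univ_unique, Finset.sum_singleton,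
    iCocycles_circleCocycle, circleCochain_apply, smul_eq_mul, mul_one, Int.cast_id]

/-- **The winding functional on the class of a loop is the winding**:
`W_φ (h γ) = windAlong φ γ` (naturality of the Kronecker pairing and of the Hurewicz class, then
`⟨θ, h(φ ∘ γ)⟩ = ϑ(φ ∘ γ) = ` lift increment). [cite: HatcherAT2002, §3.1 p. 198] -/
theorem windingFunctional_loopClass (φ : C(X, UnitAddCircle)) {x : X} (γ : Path x x) :
    (windingFunctional φ (loopClass ℤ ℤ (1 : ℤ) γ) : ℝ) = windAlong φ γ := by
  rw [windingFunctional, kroneckerPairing_map, map_loopClass,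
    kroneckerPairing_circleClass_loopClass, windAlong, liftIncrement_loop_eq_windingCochain]

/-- The winding of a loop is an integer. [cite: HatcherAT2002, Thm. 1.7] -/
theorem exists_int_windAlong (φ : C(X, UnitAddCircle)) {x : X} (γ : Path x x) :
    ∃ k : ℤ, windAlong φ γ = k :=
  ⟨_, (windingFunctional_loopClass φ γ).symm⟩

/-- **Homologous loops have the same winding.** [cite: HatcherAT2002, §3.1 p. 198] -/
theorem windAlong_eq_of_loopClass_eq (φ : C(X, UnitAddCircle)) {x y : X} {γ : Path x x}
    {γ' : Path y y} (h : loopClass ℤ ℤ (1 : ℤ) γ = loopClass ℤ ℤ (1 : ℤ) γ') :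
    windAlong φ γ = windAlong φ γ' := by
  rw [← windingFunctional_loopClass, ← windingFunctional_loopClass, h]

/-- **Additivity in homology**: if `h(γ) = Σ_i n_i h(γ_i)` in `H₁(X; ℤ)` then
`windAlong φ γ = Σ_i n_i windAlong φ γ_i`. [cite: HatcherAT2002, §3.1 p. 198] -/
theorem windAlong_eq_sum_of_loopClass_eq_sum (φ : C(X, UnitAddCircle)) {x : X} (γ : Path x x)
    {ι : Type*} (s : Finset ι) (y : ι → X) (δ : ∀ i, Path (y i) (y i)) (n : ι → ℤ)
    (h : loopClass ℤ ℤ (1 : ℤ) γ = ∑ i ∈ s, n i • loopClass ℤ ℤ (1 : ℤ) (δ i)) :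
    windAlong φ γ = ∑ i ∈ s, (n i : ℝ) * windAlong φ (δ i) := by
  rw [← windingFunctional_loopClass, h, map_sum, Int.cast_sum]
  refine Finset.sum_congr rfl fun i _ => ?_
  rw [map_zsmul, zsmul_eq_mul, Int.cast_mul, Int.cast_id, windingFunctional_loopClass]

/-- A homologically trivial loop has winding zero. [cite: HatcherAT2002, §3.1 p. 198] -/
theorem windAlong_eq_zero_of_loopClass_eq_zero (φ : C(X, UnitAddCircle)) {x : X} {γ : Path x x}
    (h : loopClass ℤ ℤ (1 : ℤ) γ = 0) : windAlong φ γ = 0 := by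
  rw [← windingFunctional_loopClass, h, map_zero, Int.cast_zero]

/-! ### Computation from real lifts -/

/-- **A real lift along the path computes the winding**: if `F` is continuous on a set `S`
containing the path and `φ = F mod 1` on `S`, then `windAlong φ γ = F(γ 1) − F(γ 0)`.
[cite: HatcherAT2002, Prop. 1.30] -/
theorem windAlong_eq_of_lift (φ : C(X, UnitAddCircle)) {x y : X} (γ : Path x y) {S : Set X}
    {F : X → ℝ} (hF : ContinuousOn F S) (hφ : ∀ z ∈ S, ((F z : ℝ) : UnitAddCircle) = φ z)
    (hγ : ∀ t, γ t ∈ S) : windAlong φ γ = F y - F x := by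
  have hc : Continuous fun t => F (γ t) :=
    hF.comp_continuous γ.continuous hγ
  rw [windAlong, liftIncrement_eq_of_lift _ ⟨fun t => F (γ t), hc⟩ fun t => ?_]
  · show F (γ 1) - F (γ 0) = F y - F x
    rw [γ.target, γ.source]
  · show ((F (γ t) : ℝ) : UnitAddCircle) = φ (γ t)
    exact hφ _ (hγ t)

/-- The same for a segment `γ[s, t]` of a path lying in `S`. [cite: HatcherAT2002, Prop. 1.30] -/
theorem windAlong_segment_eq_of_lift (φ : C(X, UnitAddCircle)) {x y : X} (γ : Path x y)
    (s t : unitInterval) {S : Set X} {F : X → ℝ} (hF : ContinuousOn F S)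
    (hφ : ∀ z ∈ S, ((F z : ℝ) : UnitAddCircle) = φ z)
    (hγ : ∀ u : unitInterval, γ.extend ((s : ℝ) + ((t : ℝ) - s) * u) ∈ S) :
    windAlong φ (segment γ s t) = F (γ t) - F (γ s) := by
  rw [windAlong_eq_of_lift φ (segment γ s t) hF hφ fun u => by rw [segment_apply]; exact hγ u,
    Path.extend_extends' γ t, Path.extend_extends' γ s]

/-- **Winding from local lifts over a partition.**  Let `t₀ = 0, …, tₙ = 1` in `[0, 1]`, and
suppose that for each `k < n` the piece `γ[t_k, t_{k+1}]` lies in a set `S_k` on which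
`φ = F_k mod 1` with `F_k` continuous on `S_k`.  Then
`windAlong φ γ = Σ_k (F_k (γ t_{k+1}) − F_k (γ t_k))`. [cite: HatcherAT2002, Prop. 1.30] -/
theorem windAlong_eq_sum_of_lifts (φ : C(X, UnitAddCircle)) {x y : X} (γ : Path x y) {n : ℕ}
    (t : Fin (n + 1) → unitInterval) (ht0 : t 0 = 0) (htn : t (Fin.last n) = 1)
    (S : Fin n → Set X) (F : Fin n → X → ℝ) (hF : ∀ k, ContinuousOn (F k) (S k))
    (hφ : ∀ k, ∀ z ∈ S k, ((F k z : ℝ) : UnitAddCircle) = φ z)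
    (hγ : ∀ (k : Fin n) (u : unitInterval),
      γ.extend ((t k.castSucc : ℝ) + ((t k.succ : ℝ) - t k.castSucc) * u) ∈ S k) :
    windAlong φ γ = ∑ k : Fin n, (F k (γ (t k.succ)) - F k (γ (t k.castSucc))) := by
  rw [windAlong, liftIncrement_eq_sum_segment _ t ht0 htn]
  refine Finset.sum_congr rfl fun k _ => ?_
  have e : segment (γ.map φ.continuous) (t k.castSucc) (t k.succ) =
      (segment γ (t k.castSucc) (t k.succ)).map φ.continuous := by
    ext u
    rfl
  rw [e]
  exact windAlong_segment_eq_of_lift φ γ _ _ (hF k) (hφ k) (hγ k)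

end Winding

end Literature.AlgebraicTopology.SingularHomology
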